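import Summits.Ventures.HodgeRepro.QuadEngine

/-!
# Degrees 6 and 8: every single-class `SumTwo` quadruple has a conjugate pair — kernel rows

Blind re-derivation cell `pub-hodge-repro`, seat `typer` (gen 5).  The check `noSingleClassSumTwo`
of `QuadEngine.lean` by kernel `decide` on the tables of the `(G, c)` of orders 6 and 8
(`CayleyTable.lean`; `C₄ × C₂` with its three central involutions, `C₂³` with all seven).  In these
degrees every `SumTwo` quadruple without a conjugate corner is a face (`FaceCriterion.lean`), so
this only re-derives `SingleClass.lean` in the engine vocabulary; it is recorded for uniformity with
`QuadRows12.lean`.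
-/

set_option autoImplicit false

open Summit.Ventures.HodgeRepro.FaceCensus

namespace HodgeRepro

/-- The table of `C₄ × C₂` with its third central involution `cc_C4xC2_ns'`. -/
def tableC4xC2'' : CMGaloisType 8 := tableOf encC4xC2 cc_C4xC2_ns'

namespace QuadEngine

/-- `C₆`: the check passes. -/
theorem noSingleClassSumTwo_C6 : noSingleClassSumTwo tableC6 = true := by decide +kernel

/-- `C₈`: the check passes. -/
theorem noSingleClassSumTwo_C8 : noSingleClassSumTwo tableC8 = true := by decide +kernel

/-- `C₄ × C₂`, involution `(2, 0)`: the check passes. -/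
theorem noSingleClassSumTwo_C4xC2 : noSingleClassSumTwo tableC4xC2 = true := by decide +kernel

/-- `C₄ × C₂`, involution `(0, 1)`: the check passes. -/
theorem noSingleClassSumTwo_C4xC2' : noSingleClassSumTwo tableC4xC2' = true := by decide +kernel

/-- `C₄ × C₂`, involution `(2, 1)`: the check passes. -/
theorem noSingleClassSumTwo_C4xC2'' : noSingleClassSumTwo tableC4xC2'' = true := by decide +kernel

/-- `C₂³`, every one of its seven involutions: the check passes. -/
theorem noSingleClassSumTwo_C2xC2xC2 :
    ∀ c : C2xC2xC2, c ≠ 1 → noSingleClassSumTwo (tableOf encC2xC2xC2 c) = true := by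
  decide +kernel

/-- `D₄`: the check passes. -/
theorem noSingleClassSumTwo_D4 : noSingleClassSumTwo tableD4 = true := by decide +kernel

/-- `Q₈`: the check passes. -/
theorem noSingleClassSumTwo_Q8 : noSingleClassSumTwo tableQ8 = true := by decide +kernel

end QuadEngine

end HodgeRepro
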